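import Summits.Parity.GeneralizedHardyLittlewood.Theorems.GreenTaoLevelTwoMNTwoPropNineteenGlue

/-!
# Route `GreenTaoLevelTwo`, crux `MNTwo` (stmt-Parity-21276), line `birth`, stub `stub_mnVertical`:
# the §10 set-up: rescaling, conjugation and the thresholds of the dichotomy (GT 2008b §10)

Block H4 (assembly tools) of the `stub_mnVertical` census (B. Green, T. Tao, *Quadratic
uniformity of the Möbius function*, Ann. Inst. Fourier 58 (2008) = arXiv:math/0606087, §10: "We
now apply Proposition 9 with `f(n) := ψ(n)e(φ(n))` and `U = V = N^{1/3}`").  Def-free tools for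
`…MNTwoPropTwentyTwoBudget`: the conjugation/rescaling identity
`‖Σ μ·(ψ/2)·e(φ)‖ = ½‖Σ μ·ψ·e(−φ)‖`, and the verification, for `N ≥ N₁(A)`, of the
polylogarithmic thresholds of `…MNTwoDichotomy.dichotomy` for the choices `u = ⌊√⌊√N⌋⌋`,
`X = N/(8 log^A N)`, `η₁ = η₂ = 10⁻⁸ log^{-(2A+5)} N`.

* `norm_sum_half_weight` — `‖Σ μ·(ψ/2)·e(φ)‖ = ½‖Σ μ·ψ·e(−φ)‖`;
* `dichotomy_thresholds` — the thresholds.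

References: [GreenTao2008QuadraticMobius] arXiv:math/0606087 §10 (proof of Prop. 22).
-/

noncomputable section

open Finset Real ArithmeticFunction Filter Asymptotics
open scoped ArithmeticFunction.Moebius FourierTransform ComplexConjugate

namespace Summit.Parity.GeneralizedHardyLittlewood.GreenTaoLevelTwoMNTwoDichotomyThresholds

open Summit.Parity.GeneralizedHardyLittlewood.GreenTaoLevelTwoMNTwoPropNineteenGlue
  (toCircle_coe_eq_fourierChar)

/-- **Rescaling and conjugating the localized Möbius sum**:
`‖Σ_{n∈S} μ(n)·(ψ(n)/2)·e(φ(n))‖ = ½‖Σ_{n∈S} μ(n)ψ(n)e(−φ(n))‖`. [folklore] -/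
theorem norm_sum_half_weight (ψ φ : ℤ → ℝ) (S : Finset ℕ) :
    ‖∑ n ∈ S, ((μ n : ℝ) : ℂ) * ((((ψ n / 2 : ℝ)) : ℂ) *
        (AddCircle.toCircle (((φ n : ℝ)) : UnitAddCircle) : ℂ))‖ =
      1 / 2 * ‖∑ n ∈ S, ((μ n : ℝ) : ℂ) * ((ψ n : ℝ) : ℂ) * (𝐞 (-(φ n)) : ℂ)‖ := by
  have hconj : ∑ n ∈ S, ((μ n : ℝ) : ℂ) * ((((ψ n / 2 : ℝ)) : ℂ) *
      (AddCircle.toCircle (((φ n : ℝ)) : UnitAddCircle) : ℂ)) =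
      (1 / 2 : ℂ) * conj (∑ n ∈ S, ((μ n : ℝ) : ℂ) * ((ψ n : ℝ) : ℂ) * (𝐞 (-(φ n)) : ℂ)) := by
    rw [map_sum, Finset.mul_sum]
    refine Finset.sum_congr rfl fun n _ => ?_
    rw [toCircle_coe_eq_fourierChar, map_mul, map_mul, Complex.conj_ofReal, Complex.conj_ofReal,
      ← Circle.coe_inv_eq_conj, ← AddChar.map_neg_eq_inv, neg_neg]
    push_cast
    ring
  rw [hconj, norm_mul, RCLike.norm_conj]
  norm_num

/-- **The thresholds of the dichotomy for the §10 choices.**  For `A > 0` there is `N₁` such that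
for `N ≥ N₁`, with `L = log^A N`, `u = ⌊√⌊√N⌋⌋` and `η = 10⁻⁸ log^{-(2A+5)} N`: `2 ≤ log N`,
`8Lu ≤ N`, `log^{-(2A+5)} N ≤ (6L)⁻¹`, `2η ≤ 1`, and the two polylogarithmic thresholds `hthrI`,
`hthrII` of `…MNTwoDichotomy.dichotomy` hold with `X = N/(8L)`, `η₁ = η₂ = η`.
[cite: GreenTao2008QuadraticMobius, §10 ("`U = V = N^{1/3}`"; here `u ≈ N^{1/4}`)] -/
theorem dichotomy_thresholds (A : ℝ) (hA : 0 < A) : ∃ N₁ : ℕ, ∀ N : ℕ, N₁ ≤ N →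
    2 ≤ Real.log N ∧
    8 * Real.log N ^ A * (Nat.sqrt (Nat.sqrt N) : ℝ) ≤ N ∧
    (Real.log N ^ (2 * A + 5))⁻¹ ≤ (6 * Real.log N ^ A)⁻¹ ∧
    2 * (1 / 10 ^ 8 * (Real.log N ^ (2 * A + 5))⁻¹) ≤ 1 ∧
    64 * (1 / 10 ^ 8 * (Real.log N ^ (2 * A + 5))⁻¹) ^ 2 * ((2 * N : ℕ) : ℝ) ^ 2 *
        (1 + Real.log ((Nat.sqrt (Nat.sqrt N) * Nat.sqrt (Nat.sqrt N) : ℕ) : ℝ)) ^ 4 *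
        (Nat.log 2 (Nat.sqrt (Nat.sqrt N) * Nat.sqrt (Nat.sqrt N)) + 1) ≤
      ((N : ℝ) / (8 * Real.log N ^ A)) ^ 2 ∧
    4 * (1 / 10 ^ 8 * (Real.log N ^ (2 * A + 5))⁻¹) * ((2 * N : ℕ) : ℝ) ^ 2 *
        ((Nat.log 2 (2 * N) : ℝ) + 1) ^ 2 * (1 + Real.log (2 * ((2 * N : ℕ) : ℝ))) ^ 3 ≤
      ((N : ℝ) / (8 * Real.log N ^ A)) ^ 2 := by
  -- `⌊log₂ n⌋ ≤ 2 log n` (since `log 2 > 1/2`)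
  have natLog_two_le : ∀ n : ℕ, 1 ≤ n → (Nat.log 2 n : ℝ) ≤ 2 * Real.log n := by
    intro n hn
    have h1 : ((2 : ℕ) ^ Nat.log 2 n : ℕ) ≤ n := Nat.pow_log_le_self 2 (by omega)
    have h2 : (2 : ℝ) ^ Nat.log 2 n ≤ n := by exact_mod_cast h1
    have h3 : (Nat.log 2 n : ℝ) * Real.log 2 ≤ Real.log n := by
      rw [← Real.log_pow]
      exact Real.log_le_log (by positivity) h2
    have h4 : (1 : ℝ) / 2 < Real.log 2 := lt_trans (by norm_num) Real.log_two_gt_d9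
    have h5 : 0 ≤ Real.log n := Real.log_nonneg (by exact_mod_cast hn)
    nlinarith [h5, (Nat.cast_nonneg (Nat.log 2 n) : (0 : ℝ) ≤ Nat.log 2 n)]
  -- `81 log^{2A} N ≤ N` for large `N`
  have hlo := (isLittleO_log_rpow_rpow_atTop (2 * A) one_pos).bound (by norm_num : (0 : ℝ) < 1 / 81)
  obtain ⟨T, hT⟩ := eventually_atTop.mp hlo
  refine ⟨⌈max T (Real.exp 2)⌉₊, fun N hN => ?_⟩
  have hN' : max T (Real.exp 2) ≤ N := (Nat.le_ceil _).trans (by exact_mod_cast hN)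
  have hTN : T ≤ N := (le_max_left _ _).trans hN'
  have hexpN : Real.exp 2 ≤ N := (le_max_right _ _).trans hN'
  have hNpos : (0 : ℝ) < N := lt_of_lt_of_le (Real.exp_pos _) hexpN
  have hN1 : 1 ≤ N := by
    have : (0 : ℝ) < N := hNpos
    exact_mod_cast Nat.one_le_iff_ne_zero.mpr (by rintro rfl; simp at this)
  have hlog2 : 2 ≤ Real.log N := by rw [Real.le_log_iff_exp_le hNpos]; exact hexpN
  have hlog1 : 1 ≤ Real.log N := by linarith
  have hlogpos : 0 < Real.log N := by linarith
  -- notation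
  have hL1 : 1 ≤ Real.log N ^ A := Real.one_le_rpow hlog1 hA.le
  have hL0 : 0 < Real.log N ^ A := by linarith
  have hΛ : Real.log N ^ (2 * A + 5) = (Real.log N ^ A) ^ 2 * Real.log N ^ 5 := by
    rw [show (2 * A + 5 : ℝ) = A * (2 : ℕ) + ((5 : ℕ) : ℝ) by push_cast; ring,
      Real.rpow_add hlogpos, Real.rpow_mul_natCast hlogpos.le, Real.rpow_natCast]
  have hΛ1 : 1 ≤ Real.log N ^ (2 * A + 5) := Real.one_le_rpow hlog1 (by linarith)
  have hΛ0 : 0 < Real.log N ^ (2 * A + 5) := by linarith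
  have hl5 : (32 : ℝ) ≤ Real.log N ^ 5 := by nlinarith [pow_le_pow_left₀ (by norm_num) hlog2 5]
  -- `81 L² ≤ N`
  have h81 : 81 * (Real.log N ^ A) ^ 2 ≤ N := by
    have h1 := hT N hTN
    rw [Real.rpow_one, Real.norm_eq_abs, Real.norm_eq_abs, abs_of_pos hNpos,
      abs_of_nonneg (Real.rpow_nonneg hlogpos.le _),
      show (2 * A : ℝ) = A * (2 : ℕ) by push_cast; ring, Real.rpow_mul_natCast hlogpos.le] at h1
    linarith
  refine ⟨hlog2, ?_, ?_, ?_, ?_, ?_⟩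
  · -- `8 L u ≤ N`
    set u := Nat.sqrt (Nat.sqrt N) with hu
    set m : ℕ := ⌈8 * Real.log N ^ A⌉₊ with hm
    have hm8 : 8 * Real.log N ^ A ≤ m := Nat.le_ceil _
    have hm9 : (m : ℝ) ≤ 9 * Real.log N ^ A := by
      have := Nat.ceil_lt_add_one (show (0 : ℝ) ≤ 8 * Real.log N ^ A by positivity)
      rw [← hm] at this; linarith
    have hmm : m * m ≤ N := by
      have h1 : ((m * m : ℕ) : ℝ) ≤ N := by
        push_cast
        nlinarith [hm9, (Nat.cast_nonneg m : (0 : ℝ) ≤ m)]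
      exact_mod_cast h1
    have hmsqrt : m ≤ Nat.sqrt N := Nat.le_sqrt.mpr hmm
    have huu : u * u ≤ Nat.sqrt N := Nat.sqrt_le (Nat.sqrt N)
    rcases Nat.eq_zero_or_pos u with hu0 | hupos
    · rw [hu0]; simp
    have hule : u ≤ Nat.sqrt N := le_trans (Nat.le_mul_of_pos_left u hupos) huu
    have key : m * u ≤ N := by
      calc m * u ≤ Nat.sqrt N * Nat.sqrt N := Nat.mul_le_mul hmsqrt hule
        _ ≤ N := Nat.sqrt_le N
    have key' : ((m : ℝ)) * (u : ℝ) ≤ N := by exact_mod_cast key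
    calc 8 * Real.log N ^ A * (u : ℝ) ≤ (m : ℝ) * (u : ℝ) :=
          mul_le_mul_of_nonneg_right hm8 (Nat.cast_nonneg _)
      _ ≤ N := key'
  · -- `log^{-(2A+5)} N ≤ (6L)⁻¹`
    apply inv_anti₀ (by positivity)
    rw [hΛ]
    nlinarith [hL1, hl5]
  · -- `2η ≤ 1`
    have : (Real.log N ^ (2 * A + 5))⁻¹ ≤ 1 := inv_le_one_of_one_le₀ hΛ1
    linarith
  · -- threshold I
    set u := Nat.sqrt (Nat.sqrt N) with hu
    set η : ℝ := 1 / 10 ^ 8 * (Real.log N ^ (2 * A + 5))⁻¹ with hη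
    have hη0 : 0 ≤ η := by positivity
    have huuN : u * u ≤ N := (Nat.sqrt_le (Nat.sqrt N)).trans (Nat.sqrt_le_self N)
    -- `1 + log (u²) ≤ 2 log N`
    have hlog_uu : Real.log ((u * u : ℕ) : ℝ) ≤ Real.log N := by
      rcases Nat.eq_zero_or_pos (u * u) with h0 | hpos
      · rw [h0]; simp [hlogpos.le]
      · exact Real.log_le_log (by exact_mod_cast hpos) (by exact_mod_cast huuN)
    have hA1 : 1 + Real.log ((u * u : ℕ) : ℝ) ≤ 2 * Real.log N := by linarith
    have hA0 : 0 ≤ 1 + Real.log ((u * u : ℕ) : ℝ) := by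
      have : 0 ≤ Real.log ((u * u : ℕ) : ℝ) := Real.log_natCast_nonneg _
      linarith
    -- `Nat.log 2 (u²) + 1 ≤ 3 log N`
    have hB1 : ((Nat.log 2 (u * u) : ℕ) : ℝ) + 1 ≤ 3 * Real.log N := by
      rcases Nat.eq_zero_or_pos (u * u) with h0 | hpos
      · rw [h0, Nat.log_zero_right, Nat.cast_zero, zero_add]; linarith
      · have := natLog_two_le (u * u) hpos
        linarith
    have hB0 : (0 : ℝ) ≤ ((Nat.log 2 (u * u) : ℕ) : ℝ) + 1 := by positivity
    -- the product bound
    have h2N : ((2 * N : ℕ) : ℝ) ^ 2 = 4 * (N : ℝ) ^ 2 := by push_cast; ring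
    have hpow4 : (1 + Real.log ((u * u : ℕ) : ℝ)) ^ 4 ≤ (2 * Real.log N) ^ 4 :=
      pow_le_pow_left₀ hA0 hA1 4
    have hkey : η ^ 2 * (Real.log N ^ A) ^ 2 * Real.log N ^ 5 ≤ 1 / 10 ^ 16 := by
      have e : η ^ 2 * (Real.log N ^ A) ^ 2 * Real.log N ^ 5 =
          1 / 10 ^ 16 * (Real.log N ^ (2 * A + 5))⁻¹ := by
        rw [hη, hΛ]
        field_simp
      rw [e]
      have : (Real.log N ^ (2 * A + 5))⁻¹ ≤ 1 := inv_le_one_of_one_le₀ hΛ1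
      nlinarith
    calc 64 * η ^ 2 * ((2 * N : ℕ) : ℝ) ^ 2 * (1 + Real.log ((u * u : ℕ) : ℝ)) ^ 4 *
          (((Nat.log 2 (u * u) : ℕ) : ℝ) + 1)
        ≤ 64 * η ^ 2 * (4 * (N : ℝ) ^ 2) * (2 * Real.log N) ^ 4 * (3 * Real.log N) := by
          rw [h2N]; gcongr
      _ = 12288 * (N : ℝ) ^ 2 * (η ^ 2 * Real.log N ^ 5) := by ring
      _ ≤ ((N : ℝ) / (8 * Real.log N ^ A)) ^ 2 := by
          rw [div_pow, le_div_iff₀ (by positivity)]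
          have : 12288 * (N : ℝ) ^ 2 * (η ^ 2 * Real.log N ^ 5) * (8 * Real.log N ^ A) ^ 2 =
              786432 * (N : ℝ) ^ 2 * (η ^ 2 * (Real.log N ^ A) ^ 2 * Real.log N ^ 5) := by ring
          rw [this]
          nlinarith [sq_nonneg (N : ℝ)]
  · -- threshold II
    set η : ℝ := 1 / 10 ^ 8 * (Real.log N ^ (2 * A + 5))⁻¹ with hη
    have hη0 : 0 ≤ η := by positivity
    have h2N1 : 1 ≤ 2 * N := by omega
    have hlog2N : Real.log ((2 * N : ℕ) : ℝ) ≤ 2 * Real.log N := by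
      push_cast
      rw [Real.log_mul (by norm_num) hNpos.ne']
      have : Real.log 2 ≤ 1 := by
        have := Real.log_two_lt_d9; linarith
      linarith
    have hB1 : ((Nat.log 2 (2 * N) : ℕ) : ℝ) + 1 ≤ 5 * Real.log N := by
      have := natLog_two_le (2 * N) h2N1
      linarith
    have hB0 : (0 : ℝ) ≤ ((Nat.log 2 (2 * N) : ℕ) : ℝ) + 1 := by positivity
    have hlog4 : Real.log 4 ≤ 2 := by
      have h := Real.log_two_lt_d9
      rw [show (4 : ℝ) = 2 ^ 2 by norm_num, Real.log_pow]; push_cast; linarith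
    have hC1 : 1 + Real.log (2 * ((2 * N : ℕ) : ℝ)) ≤ 3 * Real.log N := by
      have e : (2 * ((2 * N : ℕ) : ℝ)) = 4 * N := by push_cast; ring
      rw [e, Real.log_mul (by norm_num) hNpos.ne']
      linarith
    have hC0 : 0 ≤ 1 + Real.log (2 * ((2 * N : ℕ) : ℝ)) := by
      have : 0 ≤ Real.log (2 * ((2 * N : ℕ) : ℝ)) := by
        have e : (2 * ((2 * N : ℕ) : ℝ)) = ((4 * N : ℕ) : ℝ) := by push_cast; ring
        rw [e]; exact Real.log_natCast_nonneg _
      linarith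
    have h2N : ((2 * N : ℕ) : ℝ) ^ 2 = 4 * (N : ℝ) ^ 2 := by push_cast; ring
    have hkey : η * (Real.log N ^ A) ^ 2 * Real.log N ^ 5 = 1 / 10 ^ 8 := by
      rw [hη]
      field_simp
      rw [hΛ]
    calc 4 * η * ((2 * N : ℕ) : ℝ) ^ 2 * (((Nat.log 2 (2 * N) : ℕ) : ℝ) + 1) ^ 2 *
          (1 + Real.log (2 * ((2 * N : ℕ) : ℝ))) ^ 3
        ≤ 4 * η * (4 * (N : ℝ) ^ 2) * (5 * Real.log N) ^ 2 * (3 * Real.log N) ^ 3 := by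
          rw [h2N]; gcongr
      _ = 10800 * (N : ℝ) ^ 2 * (η * Real.log N ^ 5) := by ring
      _ ≤ ((N : ℝ) / (8 * Real.log N ^ A)) ^ 2 := by
          rw [div_pow, le_div_iff₀ (by positivity)]
          have : 10800 * (N : ℝ) ^ 2 * (η * Real.log N ^ 5) * (8 * Real.log N ^ A) ^ 2 =
              691200 * (N : ℝ) ^ 2 * (η * (Real.log N ^ A) ^ 2 * Real.log N ^ 5) := by ring
          rw [this, hkey]
          nlinarith [sq_nonneg (N : ℝ)]

end Summit.Parity.GeneralizedHardyLittlewood.GreenTaoLevelTwoMNTwoDichotomyThresholds
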